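import Mathlib
import Summits.NavierStokesRegularity.FluidComputer.AbcClassIIOrbits
import Summits.NavierStokesRegularity.FluidComputer.AbcLatticeSymmetryGenerators

/-!
# Class-II layer of the skew-cut X0 chain, Part S: closure properties of class II
(instab4 g6 — implementation 2 of the skew-cut X0 certifier, cell `ns-blowup`, 2026-08-26)

HONEST FRAMING (human ruling D-0035): nothing here is a claim about Navier–Stokes blow-up.
WHAT THIS IS NOT: not NS evidence. MODEL lane (linearisation about the forced ABC flow 1:1:1).
Sequel of `AbcClassIIDefs` (p470515) and `AbcClassIIOrbits`.

CLOSURE PROPERTIES: class II (`IsClassII`, the sign character `ρ_r c = c`, `ρ_s c = −c`) is preserved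
by the diagonal part `(x + |k|²/R)·`, by `Π X` (from instab3's
`AbcLatticeSymmetryGenerators.linOp_abcFlow_classII_invariant` at `ν = 0` and the identification
`Π[N+N] = −2π ΠX` of `AbcLatticeEigenSynthesis.lerayCoeff_linSym_abcFlow`), hence by the section
operator `secOp R x = x − L_R` (KERNEL-CHAIN (A5) for the certifiers' operator); by the conjugation
`J c = conj c(−·)` (`conj θ_s(−m) = θ_s(m)`); and by cutting down to ORBIT-CLOSED frequency sets
(orbits, punctured cubes, sup-norm shells). Conjugate symmetry and transversality are preserved by
`secOp` (`AbcLatticeReality.certifierOp_conj`, `SteadyLattice.kdot_lerayCoeff`) and by cuts.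

Mathlib + the files named; no new definitions.
-/

noncomputable section

open scoped BigOperators ComplexConjugate InnerProductSpace
open Finset MeasureTheory UnitAddTorus

namespace Summit.NavierStokesRegularity.FluidComputer.AbcClassII

open Literature.Analysis.FunctionSpaces Literature.Analysis.FunctionSpaces.Torus
open Literature.Analysis.FunctionSpaces.EuclideanSpace
open Literature.Analysis.FluidPDE Literature.Analysis.FluidPDE.SteadyLattice
open Literature.Analysis.FluidPDE.ScalarFourier

/-! ## Part S. Class II, conjugate symmetry and transversality: closure properties (instab4 g6) -/

section Symmetry

/-- Components of `rotR`. -/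
theorem rotR_apply (c : Fam) (m : Fin 3 → ℤ) (p : Fin 3) :
    rotR c m p = c (fun i : Fin 3 => m ((finRotate 3).symm i)) ((finRotate 3) p) := rfl

/-- Components of `rotS`. -/
theorem rotS_apply (c : Fam) (m : Fin 3 → ℤ) (p : Fin 3) :
    rotS c m p = (-Complex.I) ^ (m 0 + 3 * m 1 + m 2) * ((((![1, 1, -1] : Fin 3 → ℤ) p : ℤ) : ℂ) *
      c (fun i : Fin 3 => (![1, 1, -1] : Fin 3 → ℤ) ((Equiv.swap (1 : Fin 3) 2).symm i) *
        m ((Equiv.swap (1 : Fin 3) 2).symm i)) ((Equiv.swap (1 : Fin 3) 2) p)) := rfl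

/-- Hypothesis `hr` of `AbcLatticeSymmetryGenerators.linOp_abcFlow_classII_invariant` from class II. -/
theorem hr_of_isClassII {c : Fam} (hc : IsClassII c) (m : Fin 3 → ℤ) (p : Fin 3) :
    (fun _ : Fin 3 → ℤ => (1 : ℂ)) m * ((((fun _ : Fin 3 => (1 : ℤ)) p : ℤ) : ℂ) * c
      (fun i : Fin 3 => (fun _ : Fin 3 => (1 : ℤ)) ((finRotate 3).symm i) * m ((finRotate 3).symm i))
        ((finRotate 3) p)) = 1 * c m p := by
  have h := congrArg (fun f : Fam => f m p) hc.1
  simp only [rotR_apply] at h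
  simp only [Int.cast_one, one_mul]
  exact h

/-- Hypothesis `hs` of `AbcLatticeSymmetryGenerators.linOp_abcFlow_classII_invariant` from class II. -/
theorem hs_of_isClassII {c : Fam} (hc : IsClassII c) (m : Fin 3 → ℤ) (p : Fin 3) :
    (fun n : Fin 3 → ℤ => (-Complex.I) ^ (n 0 + 3 * n 1 + n 2)) m *
      ((((![1, 1, -1] : Fin 3 → ℤ) p : ℤ) : ℂ) * c
        (fun i : Fin 3 => (![1, 1, -1] : Fin 3 → ℤ) ((Equiv.swap (1 : Fin 3) 2).symm i) *
          m ((Equiv.swap (1 : Fin 3) 2).symm i)) ((Equiv.swap (1 : Fin 3) 2) p)) = (-1) * c m p := by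
  have h := congrArg (fun f : Fam => f m p) hc.2
  simp only [rotS_apply, Pi.neg_apply, PiLp.neg_apply] at h
  rw [h]; ring

/-- A scalar multiplier invariant under the two frequency maps preserves class II. -/
theorem IsClassII.smul_fun {c : Fam} (hc : IsClassII c) (f : (Fin 3 → ℤ) → ℂ)
    (hfr : ∀ m, f (fun i : Fin 3 => m ((finRotate 3).symm i)) = f m)
    (hfs : ∀ m, f (fun i : Fin 3 => (![1, 1, -1] : Fin 3 → ℤ) ((Equiv.swap (1 : Fin 3) 2).symm i) *
      m ((Equiv.swap (1 : Fin 3) 2).symm i)) = f m) :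
    IsClassII (fun k => f k • c k) := by
  refine ⟨?_, ?_⟩
  · funext m; ext p
    have h := congrArg (fun g : Fam => g m p) hc.1
    simp only [rotR_apply] at h
    simp only [rotR_apply, PiLp.smul_apply, smul_eq_mul, hfr, h]
  · funext m; ext p
    have h := congrArg (fun g : Fam => g m p) hc.2
    simp only [rotS_apply, Pi.neg_apply, PiLp.neg_apply] at h
    simp only [rotS_apply, PiLp.smul_apply, smul_eq_mul, hfs, Pi.neg_apply, PiLp.neg_apply]
    rw [← mul_neg, ← h]; ring

/-- `|k|²` is invariant under the two frequency maps (they stay in the orbit). -/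
theorem freqNormSq_rotFreq (m : Fin 3 → ℤ) :
    freqNormSq (fun i : Fin 3 => m ((finRotate 3).symm i)) = freqNormSq m ∧
    freqNormSq (fun i : Fin 3 => (![1, 1, -1] : Fin 3 → ℤ) ((Equiv.swap (1 : Fin 3) 2).symm i) *
      m ((Equiv.swap (1 : Fin 3) 2).symm i)) = freqNormSq m :=
  ⟨freqNormSq_eq_of_mem_sgnOrbit (rotFreqR_mem_sgnOrbit m),
    freqNormSq_eq_of_mem_sgnOrbit (rotFreqS_mem_sgnOrbit m)⟩

/-- The diagonal part `k ↦ (x + |k|²/R) c(k)` of the section operator preserves class II. -/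
theorem IsClassII.diag {c : Fam} (hc : IsClassII c) (R x : ℝ) :
    IsClassII (fun k => ((x + freqNormSq k / R : ℝ) : ℂ) • c k) :=
  hc.smul_fun _ (fun m => by rw [(freqNormSq_rotFreq m).1]) (fun m => by rw [(freqNormSq_rotFreq m).2])

/-- The tree's linearised operator at `ν = 0` about `abcFlow 1 1 1` IS `−2π · Π X`
(`AbcLatticeEigenSynthesis.lerayCoeff_linSym_abcFlow`). -/
theorem linOp_zero_eq (c : Fam) (k : Fin 3 → ℤ) :
    ((((0 : ℝ) * (4 * Real.pi ^ 2 * freqNormSq k)) : ℝ) : ℂ) • c k +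
      Torus.lerayCoeff k ((WithLp.toLp 2 (fun pp : Fin 3 => transportSym
          (fun jj mm => (mFourierCoeff (complexify ∘ Torus.abcFlow 1 1 1)) mm jj) (fun mm => c mm pp) k) :
          EuclideanSpace ℂ (Fin 3)) +
        (WithLp.toLp 2 (fun pp : Fin 3 => transportSym (fun jj mm => c mm jj)
          (fun mm => (mFourierCoeff (complexify ∘ Torus.abcFlow 1 1 1)) mm pp) k) : EuclideanSpace ℂ (Fin 3))) =
      (-(2 * Real.pi : ℂ)) • Torus.lerayCoeff k (crossForm 1 1 1 c k) := by
  rw [AbcLatticeEigenSynthesis.lerayCoeff_linSym_abcFlow, crossForm]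
  simp

/-- **Class II is invariant under `Π X`** (KERNEL-CHAIN (A5) for the certifiers' operator; from
instab3's `linOp_abcFlow_classII_invariant` at `ν = 0` and `Π[N+N] = −2π ΠX`). -/
theorem IsClassII.lerayCrossForm {c : Fam} (hc : IsClassII c) :
    IsClassII (fun k => Torus.lerayCoeff k (crossForm 1 1 1 c k)) := by
  obtain ⟨H1, H2⟩ := AbcLatticeSymmetryGenerators.linOp_abcFlow_classII_invariant 1 0 c
    (hr_of_isClassII hc) (hs_of_isClassII hc)
  have hπ : (-(2 * Real.pi : ℂ)) ≠ 0 := by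
    have : (Real.pi : ℂ) ≠ 0 := by exact_mod_cast Real.pi_ne_zero
    exact neg_ne_zero.mpr (mul_ne_zero two_ne_zero this)
  have hY : IsClassII (fun k => (-(2 * Real.pi : ℂ)) • Torus.lerayCoeff k (crossForm 1 1 1 c k)) := by
    refine ⟨?_, ?_⟩
    · funext m; ext p
      have h := H1 m p
      rw [linOp_zero_eq, linOp_zero_eq] at h
      simp only [Int.cast_one, one_mul] at h
      rw [rotR_apply]
      exact h
    · funext m; ext p
      have h := H2 m p
      rw [linOp_zero_eq, linOp_zero_eq] at h
      rw [rotS_apply, Pi.neg_apply, PiLp.neg_apply, h]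
      ring
  have h := hY.smul ((-(2 * Real.pi : ℂ))⁻¹)
  have e : ((-(2 * Real.pi : ℂ))⁻¹ • fun k => (-(2 * Real.pi : ℂ)) • Torus.lerayCoeff k (crossForm 1 1 1 c k)) =
      fun k => Torus.lerayCoeff k (crossForm 1 1 1 c k) := by
    funext k
    rw [Pi.smul_apply, smul_smul, inv_mul_cancel₀ hπ, one_smul]
  rw [e] at h
  exact h

/-- **The section operator preserves class II.** -/
theorem IsClassII.secOp {c : Fam} (hc : IsClassII c) (R x : ℝ) : IsClassII (secOp R x c) := by
  have e : AbcClassII.secOp R x c = (fun k => ((x + freqNormSq k / R : ℝ) : ℂ) • c k) +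
      (-1 : ℂ) • (fun k => Torus.lerayCoeff k (crossForm 1 1 1 c k)) := by
    funext k; simp [AbcClassII.secOp, sub_eq_add_neg]
  rw [e]
  exact (hc.diag R x).add (hc.lerayCrossForm.smul _)

/-- `conj θ_s(−m) = θ_s(m)`. -/
theorem conj_theta_neg (m : Fin 3 → ℤ) :
    (starRingEnd ℂ) ((-Complex.I) ^ (-m 0 + 3 * -m 1 + -m 2)) = (-Complex.I) ^ (m 0 + 3 * m 1 + m 2) := by
  have en : (-m 0 + 3 * -m 1 + -m 2) = -(m 0 + 3 * m 1 + m 2) := by ring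
  rw [en, map_zpow₀, map_neg, Complex.conj_I, neg_neg, zpow_neg, ← inv_zpow, Complex.inv_I]

/-- **The conjugation `J c = conj c(−·)` preserves class II.** -/
theorem IsClassII.conj {c : Fam} (hc : IsClassII c) : IsClassII (fun k => conjVec (c (-k))) := by
  refine ⟨?_, ?_⟩
  · funext m; ext p
    rw [rotR_apply, conjVec_apply, conjVec_apply]
    have h := congrArg (fun g : Fam => g (-m) p) hc.1
    simp only [rotR_apply] at h
    have e : (-fun i : Fin 3 => m ((finRotate 3).symm i)) = fun i : Fin 3 => (-m) ((finRotate 3).symm i) := by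
      funext i; simp
    rw [e, h]
  · funext m; ext p
    rw [Pi.neg_apply, PiLp.neg_apply, rotS_apply, conjVec_apply, conjVec_apply]
    have h := congrArg (fun g : Fam => g (-m) p) hc.2
    simp only [rotS_apply, Pi.neg_apply, PiLp.neg_apply] at h
    have e : (-fun i : Fin 3 => (![1, 1, -1] : Fin 3 → ℤ) ((Equiv.swap (1 : Fin 3) 2).symm i) *
        m ((Equiv.swap (1 : Fin 3) 2).symm i)) = fun i : Fin 3 =>
        (![1, 1, -1] : Fin 3 → ℤ) ((Equiv.swap (1 : Fin 3) 2).symm i) * (-m) ((Equiv.swap (1 : Fin 3) 2).symm i) := by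
      funext i; simp
    rw [e]
    have hc' := congrArg (starRingEnd ℂ) h
    rw [map_mul, map_mul, map_neg, map_intCast, conj_theta_neg] at hc'
    exact hc'

/-- **The section operator commutes with `J`**: `(x − L_R)(Jc)(k) = conj ((x − L_R)c(−k))`
(`AbcLatticeReality.certifierOp_conj`). -/
theorem secOp_conj (R x : ℝ) (c : Fam) (k : Fin 3 → ℤ) :
    secOp R x (fun m => conjVec (c (-m))) k = conjVec (secOp R x c (-k)) :=
  AbcLatticeReality.certifierOp_conj 1 1 1 R x c k

/-- **The section operator preserves conjugate symmetry.** -/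
theorem isConjSymm_secOp {c : Fam} (hc : Torus.IsConjSymm c) (R x : ℝ) : Torus.IsConjSymm (secOp R x c) := by
  have hJ : (fun m => conjVec (c (-m))) = c := by
    funext m; rw [hc m, conjVec_conjVec]
  intro k
  have h := secOp_conj R x c (-k)
  rw [hJ, neg_neg] at h
  exact h

/-- **The section operator preserves transversality** (`k · Π_k v = 0`). -/
theorem kdot_secOp {c : Fam} (hct : ∀ k : Fin 3 → ℤ, ∑ j : Fin 3, ((k j : ℤ) : ℂ) * c k j = 0)
    (R x : ℝ) (k : Fin 3 → ℤ) : ∑ j : Fin 3, ((k j : ℤ) : ℂ) * secOp R x c k j = 0 := by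
  simp only [AbcClassII.secOp, PiLp.sub_apply, PiLp.smul_apply, smul_eq_mul, mul_sub, Finset.sum_sub_distrib]
  rw [kdot_lerayCoeff]
  have : ∑ j : Fin 3, ((k j : ℤ) : ℂ) * (((x + freqNormSq k / R : ℝ) : ℂ) * c k j) =
      ((x + freqNormSq k / R : ℝ) : ℂ) * ∑ j : Fin 3, ((k j : ℤ) : ℂ) * c k j := by
    rw [Finset.mul_sum]; refine Finset.sum_congr rfl fun j _ => ?_; ring
  rw [this, hct k, mul_zero, sub_zero]

/-! ### Restriction to orbit-closed frequency sets -/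

/-- Orbit-closed sets are closed under the two frequency maps and under negation. -/
theorem mem_iff_of_orbitClosed {S : Finset (Fin 3 → ℤ)} (hS : ∀ k ∈ S, sgnOrbit k ⊆ S)
    {k m : Fin 3 → ℤ} (hm : m ∈ sgnOrbit k) : k ∈ S ↔ m ∈ S :=
  ⟨fun hk => hS k hk hm, fun hmS => hS m hmS (mem_sgnOrbit_comm.mp hm)⟩

/-- Cutting a class-II family down to an orbit-closed set keeps it class II. -/
theorem IsClassII.cut {c : Fam} (hc : IsClassII c) {S : Finset (Fin 3 → ℤ)} (hS : ∀ k ∈ S, sgnOrbit k ⊆ S) :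
    IsClassII (fun k => if k ∈ S then c k else 0) := by
  refine ⟨?_, ?_⟩
  · funext m; ext p
    have h := congrArg (fun g : Fam => g m p) hc.1
    simp only [rotR_apply] at h
    rw [rotR_apply]
    by_cases hm : m ∈ S
    · rw [if_pos hm, if_pos ((mem_iff_of_orbitClosed hS (rotFreqR_mem_sgnOrbit m)).mp hm), h]
    · rw [if_neg hm, if_neg (fun h' => hm ((mem_iff_of_orbitClosed hS (rotFreqR_mem_sgnOrbit m)).mpr h'))]
      simp
  · funext m; ext p
    have h := congrArg (fun g : Fam => g m p) hc.2
    simp only [rotS_apply, Pi.neg_apply, PiLp.neg_apply] at h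
    rw [rotS_apply, Pi.neg_apply, PiLp.neg_apply]
    by_cases hm : m ∈ S
    · rw [if_pos hm, if_pos ((mem_iff_of_orbitClosed hS (rotFreqS_mem_sgnOrbit m)).mp hm), h]
    · rw [if_neg hm, if_neg (fun h' => hm ((mem_iff_of_orbitClosed hS (rotFreqS_mem_sgnOrbit m)).mpr h'))]
      simp

/-- Cutting down to a set symmetric under `k ↦ −k` keeps conjugate symmetry. -/
theorem isConjSymm_cut {c : Fam} (hc : Torus.IsConjSymm c) {S : Finset (Fin 3 → ℤ)}
    (hS : ∀ k ∈ S, -k ∈ S) : Torus.IsConjSymm (fun k => if k ∈ S then c k else 0) := by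
  intro k
  by_cases hk : k ∈ S
  · have hnk : -k ∈ S := hS k hk
    simp only [if_pos hk, if_pos hnk, hc k]
  · have hnk : -k ∉ S := fun h => hk (by simpa using hS (-k) h)
    simp only [if_neg hk, if_neg hnk, conjVec_zero]

/-- Cutting down keeps transversality. -/
theorem kdot_cut {c : Fam} (hct : ∀ k : Fin 3 → ℤ, ∑ j : Fin 3, ((k j : ℤ) : ℂ) * c k j = 0)
    (S : Finset (Fin 3 → ℤ)) (k : Fin 3 → ℤ) :
    ∑ j : Fin 3, ((k j : ℤ) : ℂ) * (fun m => if m ∈ S then c m else (0 : EuclideanSpace ℂ (Fin 3))) k j = 0 := by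
  by_cases hk : k ∈ S
  · simp only [if_pos hk, hct k]
  · simp [if_neg hk]

/-- Orbits are orbit-closed. -/
theorem Orbit.orbitClosed (O : Orbit) : ∀ k ∈ O.1, sgnOrbit k ⊆ O.1 := fun _ hk => (O.sgnOrbit_eq hk).le

/-- The punctured cube `cube n ∖ {0}` is orbit-closed. -/
theorem orbitClosed_cube_ne_zero (n : ℕ) : ∀ k ∈ (cube n).filter (fun k => k ≠ 0),
    sgnOrbit k ⊆ (cube n).filter (fun k => k ≠ 0) := by
  intro k hk m hm
  rw [Finset.mem_filter] at hk ⊢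
  exact ⟨sgnOrbit_subset_cube hk.1 hm, ne_zero_of_mem_sgnOrbit hk.2 hm⟩

/-- A sup-norm shell `cube (n+1) ∖ cube n` is orbit-closed. -/
theorem orbitClosed_shell (n : ℕ) : ∀ k ∈ cube (n + 1) \ cube n, sgnOrbit k ⊆ cube (n + 1) \ cube n := by
  intro k hk m hm
  rw [Finset.mem_sdiff, mem_cube_iff_supNorm, mem_cube_iff_supNorm] at hk ⊢
  rw [supNorm_eq_of_mem_sgnOrbit hm]
  exact hk

/-- Orbit-closed sets are symmetric under negation. -/
theorem neg_mem_of_orbitClosed {S : Finset (Fin 3 → ℤ)} (hS : ∀ k ∈ S, sgnOrbit k ⊆ S) :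
    ∀ k ∈ S, -k ∈ S := fun k hk => hS k hk (neg_self_mem_sgnOrbit k)

end Symmetry

section SymmetryExtra

/-- `Π X` preserves conjugate symmetry (`AbcLatticeReality.isConjSymm_crossForm` + `Π_{−k} conj = conj Π_k`). -/
theorem isConjSymm_lerayCrossForm {c : Fam} (hc : Torus.IsConjSymm c) :
    Torus.IsConjSymm (fun k => Torus.lerayCoeff k (crossForm 1 1 1 c k)) := by
  intro k
  have h : crossForm 1 1 1 c (-k) = conjVec (crossForm 1 1 1 c k) :=
    AbcLatticeReality.isConjSymm_crossForm 1 1 1 hc k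
  show Torus.lerayCoeff (-k) (crossForm 1 1 1 c (-k)) = conjVec (Torus.lerayCoeff k (crossForm 1 1 1 c k))
  rw [h, lerayCoeff_neg_conjVec]

/-- `J c` is transversal when `c` is. -/
theorem kdot_conj {c : Fam} (hct : ∀ k : Fin 3 → ℤ, ∑ j : Fin 3, ((k j : ℤ) : ℂ) * c k j = 0)
    (k : Fin 3 → ℤ) : ∑ j : Fin 3, ((k j : ℤ) : ℂ) * (conjVec (c (-k))) j = 0 := by
  have h := congrArg (starRingEnd ℂ) (hct (-k))
  rw [map_sum, map_zero] at h
  rw [← neg_eq_zero, ← h, ← Finset.sum_neg_distrib]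
  refine Finset.sum_congr rfl fun j _ => ?_
  rw [conjVec_apply, map_mul, map_intCast, Pi.neg_apply, Int.cast_neg]
  ring

/-- `J c` is supported where `c` is, for supports symmetric under negation. -/
theorem conj_eq_zero_of_not_mem {c : Fam} {S : Finset (Fin 3 → ℤ)} (hS : ∀ k ∈ S, -k ∈ S)
    (hc : ∀ k ∉ S, c k = 0) (k : Fin 3 → ℤ) (hk : k ∉ S) : conjVec (c (-k)) = 0 := by
  have hnk : -k ∉ S := fun h => hk (by simpa using hS (-k) h)
  rw [hc (-k) hnk, conjVec_zero]

end SymmetryExtra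

section SymmetryExtra2

/-- Class II is closed under negation. -/
theorem IsClassII.neg {c : Fam} (hc : IsClassII c) : IsClassII (-c) := by
  have h := hc.smul (-1 : ℂ)
  rwa [neg_one_smul] at h

/-- Class II is closed under subtraction. -/
theorem IsClassII.sub {c d : Fam} (hc : IsClassII c) (hd : IsClassII d) : IsClassII (c - d) := by
  rw [sub_eq_add_neg]; exact hc.add hd.neg

end SymmetryExtra2

end Summit.NavierStokesRegularity.FluidComputer.AbcClassII

end
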